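import Summits.QuantumFields.BalabanUV.Beta.GAN24.DerivativeRateTransferSqueeze
import Summits.QuantumFields.BalabanUV.Beta.GAN24.DerivativeRateTransferLoewnerEnd

/-!
# `BalabanUV.Beta.GAN24.DerivativeRateTransferAccretive` — binder row G-an2-4 ∕ (CONV-C), route R6 «VALUES, NOT DERIVATIVES», PART 35:
# «ACCRETIVE S2» IN COMPLEX LETTERS, I — the bordered matrix of a complex-symmetric fine form `Â + i•K̂` (`A` real PSD, `K` real symmetric)
# with a REAL constraint map `Q̂` is nonsingular as soon as the real one `kkt(A,Q)` is (NO radius in `K`), and the two Euler–Lagrange tests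
# `𝒮(a,b) = 𝒮_A(a,b) + i·(w_a·K̂u_b)`, `Re 𝒮(b,b) = Re ū_b·Âu_b` (unit b2b-balaban-gan24-p3, gen 39; the lens item «ACCRETIVE S2» of gan24-idea-1 g45 —
# scratch `AccretiveEffFormSketch` 600f412275675657 in the REAL letters `S + J` — re-typed DIRECTLY OVER `ℂ`, so that it lands on PART 32 END's `hdet` ∕ `hB`
# without a realification dictionary; companion PART 36 `…AccretiveBound` carries the sector letter and the entry bound)

NOT IN PRINT; OUR PROOF (for the ROUTE; [folklore] finite-dimensional linear algebra — an2's bordered letters `kkt ∕ effForm ∕ minOp`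
(`Beta.CompositionSingular`, any field) BY NAME, PART 18's one-vector identities, PART 19's `effForm_map ∕ minOp_map ∕ kkt_map`).  HONEST
FRAMING (cell contract, verbatim): «discharging `BetaPertH` makes Bałaban's UV stability UNCONDITIONAL — a real constructive-QFT result; it is NOT
the continuum limit and NOT the Clay problem.»  HONEST DEPENDENCY (verbatim): «continuum YM on T⁴ ⇐ BetaPertH ∧ nine spine estimates (0/9 proved);
BetaPertH ⇐ (D1) ∧ (D4) ∧ CAP+tail; G-an2-4 gates asym, D1 and NE2/3/4.»

WHY THIS FILE.  PART 32 END (`dEffForm_step_rateω_of_stabGram_of_prolGram_of_row`) keeps ONE complex letter, S2 = `hdet` (the complexified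
bordered matrices `kkt(Ĥ_k + z₁Ĥ₁ₖ + z₂Ĥ₂ₖ, Q̂_k + z₁Q̂₁ₖ + z₂Q̂₂ₖ)` are nonsingular on the bidisc) + `hB` (`‖𝒮_k(z)_{ab}‖ ≤ B` there).  On an
AXIAL SLICE (`Q₁ = Q₂ = 0`: the constraint map does not move with the background) the complexified fine form at `z = x + iy` is `Â(x) + i·K̂(y)`
with `A(x) = H + x₁H₁ + x₂H₂` the REAL family member and `K(y) = y₁H₁ + y₂H₂` REAL SYMMETRIC, the constraint map real (PART 36
`affine₂_map_eq_accretive`).  For such a datum a kernel pair `(u,λ)` of `kkt(Â + iK̂, Q̂)` has `ū·(Â + iK̂)u = −(Q̂ū)·λ = 0` with BOTH `ū·Âu`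
and `ū·K̂u` real, so `ū·Âu = 0`, `Âu = 0`, `(u,0) ∈ ker kkt(Â,Q̂)`, `u = 0`, `λ = 0`: `hdet` from the real point, NO smallness of `K` (§3 (D)).
Testing Euler–Lagrange of `Â + iK̂` on the REAL minimiser `w_a = ℋ_Â e_a` gives `𝒮(a,b) = 𝒮_A(a,b) + i·w_a·K̂u_b` (`u_b` the complex minimiser;
(X)), testing it on `ū_b` — admissible BECAUSE the constraint map is real — gives `Re 𝒮(b,b) = Re ū_b·Âu_b` ((V)); PART 36 turns these and the
sector letter `±K ≤ κA` into `Re 𝒮(b,b) ≤ (2+κ²)𝒮_A(b,b)` and `‖𝒮(a,b)‖ ≤ (1 + κ√(2+κ²))·Λ` = `hB`'s shape from REAL-POINT letters.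

WHAT THIS FILE PROVES (0 sorry, 0 `def`, nothing cited):
* §1 [folklore] scalar extension `ℝ → ℂ` at one vector: `ofReal_mulVec`, `ofReal_dotProduct`, `star_ofReal`, `eq_re_add_im`,
  `re_star_dotProduct_map_mulVec` (`Re ū·N̂u = x·Nx + y·Ny`), `im_star_dotProduct_map_mulVec` (`= 0` for symmetric `N`), `star_dotProduct_map_mulVec`,
  **`posSemidef_map_ofReal`** (a real PSD matrix is PSD over `ℂ`), `map_mulVec_eq_zero_of_re_eq_zero` (`Re ū·Âu = 0 ⟹ Âu = 0`), `star_map_mulVec`.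
* §2 [folklore] bilinear bordered identities over a field: `constraint_mulVec_minOp` (`Q(ℋv) = v`), **`trial_dotProduct_minOp`** ((T):
  `Qw = v′ ⟹ w·M(ℋv) = v′·𝒮v`, ANY `M` — gan24-idea-1 g45's (T), any field), `dotProduct_mulVec_comm_of_transpose`, `single_dotProduct_mulVec_single'`.
* §3 the accretive datum `(Â + i•K̂, Q̂)`: `minOp_map_single`; **`isUnit_det_kkt_accretive`** ((D): `hdet` FOR FREE); **`effForm_accretive_apply`**
  ((X): `𝒮(a,b) = 𝒮_A(a,b) + i·(w_a·K̂u_b)`); **`re_effForm_accretive_diag`** ((V): `Re 𝒮(b,b) = Re ū_b·Âu_b`).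
WHAT IT DOES NOT DO: the Q-JETS (`Q₁, Q₂ ≠ 0`: [B9] p. 417 (3.110) — the averaging depends on the background): with a COMPLEX constraint map the
kernel argument has no conjugation symmetry and `hdet` CAN fail (gan24-idea-1 g45 toy t45: near-singular dips on the imaginary axis at
`|Im z| ≈ 1∕‖Q⁺Q₁‖`); they are covered only perturbatively (constraint straightening, gan24-idea-1 g45 `StraighteningSketch` 95225f12a41a36d3); nothing of
Bałaban's is instantiated; S2(ii), `Λ`, the sector letter for the true towers: displayed.  SUPPLIER work on route R6 (rank 2, REDUCTION, no seat); no
consumer of record; NEVER «G-an2-4 closed»; NOT (CONV-C), NOT D1, NOT `BetaPertH`, NOT continuum, NOT Clay.  Records: `HOME/b2b-balaban-gan24-p3/WOODBURY-FIBRE.md` v13.9.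
-/

noncomputable section

open Matrix
open scoped ComplexOrder

namespace Summit.QuantumFields.BalabanUV.Beta.GAN24.DerivativeRateTransferAccretive

open Literature.MathematicalPhysics.QuantumFieldTheory.Balaban1983to89.Beta.Composition (kkt)
open Literature.MathematicalPhysics.QuantumFieldTheory.Balaban1983to89.Beta.CompositionSingular (effForm minOp mul_minOp mul_minOp_eq
  minOpL_eq_transpose kkt_eq_fromBlocks)
open Summit.QuantumFields.BalabanUV.Beta.GAN24.DerivativeRateTransferLoewnerKKT (transpose_eq_of_posSemidef)
open Summit.QuantumFields.BalabanUV.Beta.GAN24.DerivativeRateTransferLoewnerEnd (kkt_map effForm_map minOp_map isUnit_det_map)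

/-! ## §1 Scalar extension `ℝ → ℂ` at one vector [folklore] -/

section Extension

variable {ν ν' : Type*} [Fintype ν] [Fintype ν']

omit [Fintype ν'] in
/-- [folklore] `N̂·p̂ = (N·p)^`. -/
theorem ofReal_mulVec (N : Matrix ν' ν ℝ) (p : ν → ℝ) :
    N.map (Complex.ofRealHom : ℝ →+* ℂ) *ᵥ (fun i => (p i : ℂ)) = fun i => (((N *ᵥ p) i : ℝ) : ℂ) := by
  funext i
  simp only [mulVec, dotProduct, Matrix.map_apply, Complex.ofRealHom_eq_coe]
  push_cast
  rfl

/-- [folklore] `p̂·q̂ = (p·q)^`. -/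
theorem ofReal_dotProduct (p q : ν → ℝ) : (fun i => (p i : ℂ)) ⬝ᵥ (fun i => (q i : ℂ)) = ((p ⬝ᵥ q : ℝ) : ℂ) := by
  simp only [dotProduct]
  push_cast
  rfl

omit [Fintype ν] in
/-- [folklore] a complexified real vector is self-conjugate. -/
theorem star_ofReal (p : ν → ℝ) : star (fun i => (p i : ℂ)) = fun i => (p i : ℂ) := by
  funext i
  simp [Complex.conj_ofReal]

omit [Fintype ν] in
/-- [folklore] `u = (Re u)^ + i•(Im u)^`. -/
theorem eq_re_add_im (u : ν → ℂ) : u = (fun i => ((u i).re : ℂ)) + Complex.I • (fun i => ((u i).im : ℂ)) := by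
  funext i
  simp only [Pi.add_apply, Pi.smul_apply, smul_eq_mul]
  rw [mul_comm]
  exact (Complex.re_add_im (u i)).symm

/-- [folklore] **`Re ū·N̂u = x·Nx + y·Ny`** (`x = Re u`, `y = Im u`; any real square `N`). -/
theorem re_star_dotProduct_map_mulVec (N : Matrix ν ν ℝ) (u : ν → ℂ) :
    (star u ⬝ᵥ (N.map (Complex.ofRealHom : ℝ →+* ℂ) *ᵥ u)).re =
      (fun i => (u i).re) ⬝ᵥ (N *ᵥ fun i => (u i).re) + (fun i => (u i).im) ⬝ᵥ (N *ᵥ fun i => (u i).im) := by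
  simp only [dotProduct, mulVec, Matrix.map_apply, Complex.ofRealHom_eq_coe, Pi.star_apply, Complex.star_def, Complex.re_sum,
    Complex.mul_re, Complex.conj_re, Complex.conj_im, Complex.im_sum, Complex.mul_im, Complex.ofReal_re, Complex.ofReal_im, zero_mul,
    sub_zero, add_zero, ← Finset.sum_add_distrib]
  refine Finset.sum_congr rfl fun i _ => ?_
  simp only [neg_mul, Finset.sum_neg_distrib, sub_neg_eq_add, Finset.mul_sum]

/-- [folklore] the imaginary part vanishes for SYMMETRIC `N`: `Im ū·N̂u = 0`. -/
theorem im_star_dotProduct_map_mulVec {N : Matrix ν ν ℝ} (hN : Nᵀ = N) (u : ν → ℂ) :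
    (star u ⬝ᵥ (N.map (Complex.ofRealHom : ℝ →+* ℂ) *ᵥ u)).im = 0 := by
  have herm : (N.map (Complex.ofRealHom : ℝ →+* ℂ)).IsHermitian := by
    ext i j
    have hij : N j i = N i j := by simpa using congrFun (congrFun hN i) j
    simp [Matrix.conjTranspose_apply, Matrix.map_apply, hij]
  have hself : star (star u ⬝ᵥ (N.map (Complex.ofRealHom : ℝ →+* ℂ) *ᵥ u)) = star u ⬝ᵥ (N.map (Complex.ofRealHom : ℝ →+* ℂ) *ᵥ u) := by
    conv_lhs => rw [star_dotProduct, star_star, star_mulVec, herm.eq, ← dotProduct_mulVec]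
  have := congrArg Complex.im hself
  simp only [Complex.star_def, Complex.conj_im] at this
  linarith

/-- [folklore] with `im = 0`: `ū·N̂u = (x·Nx + y·Ny)^`. -/
theorem star_dotProduct_map_mulVec {N : Matrix ν ν ℝ} (hN : Nᵀ = N) (u : ν → ℂ) :
    star u ⬝ᵥ (N.map (Complex.ofRealHom : ℝ →+* ℂ) *ᵥ u) =
      (((fun i => (u i).re) ⬝ᵥ (N *ᵥ fun i => (u i).re) + (fun i => (u i).im) ⬝ᵥ (N *ᵥ fun i => (u i).im) : ℝ) : ℂ) := by
  apply Complex.ext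
  · rw [re_star_dotProduct_map_mulVec, Complex.ofReal_re]
  · rw [im_star_dotProduct_map_mulVec hN, Complex.ofReal_im]

/-- [folklore] **a real PSD matrix is PSD over `ℂ`**. -/
theorem posSemidef_map_ofReal {A : Matrix ν ν ℝ} (hA : A.PosSemidef) : (A.map (Complex.ofRealHom : ℝ →+* ℂ)).PosSemidef := by
  have hAt : Aᵀ = A := transpose_eq_of_posSemidef hA
  have herm : (A.map (Complex.ofRealHom : ℝ →+* ℂ)).IsHermitian := by
    ext i j
    have hij : A j i = A i j := by simpa using congrFun (congrFun hAt i) j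
    simp [Matrix.conjTranspose_apply, Matrix.map_apply, hij]
  refine PosSemidef.of_dotProduct_mulVec_nonneg herm fun u => ?_
  rw [star_dotProduct_map_mulVec hAt]
  have h1 := hA.dotProduct_mulVec_nonneg (fun i => (u i).re)
  have h2 := hA.dotProduct_mulVec_nonneg (fun i => (u i).im)
  simp only [star_trivial] at h1 h2
  exact Complex.zero_le_real.mpr (add_nonneg h1 h2)

/-- [folklore] for real PSD `A`: `Re ū·Âu = 0 ⟹ Âu = 0`. -/
theorem map_mulVec_eq_zero_of_re_eq_zero {A : Matrix ν ν ℝ} (hA : A.PosSemidef) (u : ν → ℂ)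
    (h0 : (star u ⬝ᵥ (A.map (Complex.ofRealHom : ℝ →+* ℂ) *ᵥ u)).re = 0) : A.map (Complex.ofRealHom : ℝ →+* ℂ) *ᵥ u = 0 := by
  have hz : star u ⬝ᵥ (A.map (Complex.ofRealHom : ℝ →+* ℂ) *ᵥ u) = 0 := by
    apply Complex.ext
    · rw [h0, Complex.zero_re]
    · rw [im_star_dotProduct_map_mulVec (transpose_eq_of_posSemidef hA), Complex.zero_im]
  exact ((posSemidef_map_ofReal hA).dotProduct_mulVec_zero_iff u).mp hz

omit [Fintype ν'] in
/-- [folklore] `(Q̂·u)⋆ = Q̂·ū` for a REAL matrix `Q`. -/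
theorem star_map_mulVec (Q : Matrix ν' ν ℝ) (u : ν → ℂ) :
    star (Q.map (Complex.ofRealHom : ℝ →+* ℂ) *ᵥ u) = Q.map (Complex.ofRealHom : ℝ →+* ℂ) *ᵥ star u := by
  funext i
  simp [mulVec, dotProduct, Matrix.map_apply, star_sum]

/-- [folklore] `Re (i·c) = −Im c`, recorded in the form used below: if `Im c = 0` then `Re (a + i·c) = Re a`. -/
theorem re_add_I_mul_of_im_eq_zero (a c : ℂ) (hc : c.im = 0) : (a + Complex.I * c).re = a.re := by
  simp [Complex.add_re, Complex.mul_re, hc]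

end Extension

/-! ## §2 Two bilinear bordered identities over a field [folklore] -/

section Bilinear

variable {𝕜 : Type*} [Field 𝕜] {ν μ : Type*} [Fintype ν] [Fintype μ] [DecidableEq ν] [DecidableEq μ]
variable {M : Matrix ν ν 𝕜} {Q : Matrix μ ν 𝕜}

/-- [folklore] the minimiser is admissible: `Q(ℋv) = v`. -/
theorem constraint_mulVec_minOp (h : IsUnit (kkt M Q).det) (v : μ → 𝕜) : Q *ᵥ (minOp M Q *ᵥ v) = v := by
  rw [mulVec_mulVec, mul_minOp M Q h, one_mulVec]

/-- **(T) EVERY ADMISSIBLE TRIAL FIELD TESTS EULER–LAGRANGE TO A VALUE OF THE EFFECTIVE FORM** [folklore; gan24-idea-1 g45 (T), any field]: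
`Qw = v′ ⟹ w·M(ℋv) = v′·𝒮v` — NO symmetry of `M`. -/
theorem trial_dotProduct_minOp (h : IsUnit (kkt M Q).det) {w : ν → 𝕜} {v v' : μ → 𝕜} (hw : Q *ᵥ w = v') :
    w ⬝ᵥ (M *ᵥ (minOp M Q *ᵥ v)) = v' ⬝ᵥ (effForm M Q *ᵥ v) := by
  rw [mulVec_mulVec, mul_minOp_eq M Q h, ← mulVec_mulVec, dotProduct_mulVec w, vecMul_transpose, hw]

omit [DecidableEq ν] in
/-- [folklore] `p·Nq = q·Np` for symmetric `N`. -/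
theorem dotProduct_mulVec_comm_of_transpose {N : Matrix ν ν 𝕜} (hN : Nᵀ = N) (p q : ν → 𝕜) : p ⬝ᵥ (N *ᵥ q) = q ⬝ᵥ (N *ᵥ p) := by
  rw [dotProduct_mulVec, ← mulVec_transpose, hN, dotProduct_comm]

omit [Fintype ν] [DecidableEq ν] in
/-- [folklore] `e_a·(E e_b) = E_{ab}`. -/
theorem single_dotProduct_mulVec_single' (E : Matrix μ μ 𝕜) (a b : μ) :
    Pi.single a (1 : 𝕜) ⬝ᵥ (E *ᵥ Pi.single b 1) = E a b := by
  rw [single_dotProduct, one_mul, Matrix.mulVec_single_one, Matrix.col_apply]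

end Bilinear

/-! ## §3 The accretive datum `(Â + i•K̂, Q̂)` with real constraint map -/

section Accretive

variable {ν μ : Type*} [Fintype ν] [Fintype μ] [DecidableEq ν] [DecidableEq μ]
variable {A K : Matrix ν ν ℝ} {Q : Matrix μ ν ℝ} {κ Λ : ℝ}

omit [Fintype ν] [Fintype μ] [DecidableEq ν] [DecidableEq μ] in
/-- [folklore] the transpose of a complexified matrix. -/
theorem transpose_map_ofReal {m n : Type*} (N : Matrix m n ℝ) :
    (N.map (Complex.ofRealHom : ℝ →+* ℂ))ᵀ = Nᵀ.map (Complex.ofRealHom : ℝ →+* ℂ) := rfl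

omit [Fintype ν] [Fintype μ] [DecidableEq ν] in
/-- [folklore] `e_a⋆ = e_a` over `ℂ`. -/
theorem star_single (a : μ) : star (Pi.single a (1 : ℂ) : μ → ℂ) = Pi.single a 1 := by
  ext i; by_cases h : i = a <;> simp [h, Pi.single_eq_of_ne]

omit [Fintype ν] [Fintype μ] [DecidableEq ν] in
/-- [folklore] the complexified real unit vector is the complex unit vector. -/
theorem ofReal_single (a : μ) : (fun i => ((Pi.single a (1 : ℝ) : μ → ℝ) i : ℂ)) = Pi.single a 1 := by
  funext i; by_cases h : i = a
  · subst h; simp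
  · simp [Pi.single_eq_of_ne h]

/-- [folklore] the complexified real minimiser of a unit source: `ℋ_Â e_a = (ℋ_A e_a)^`. -/
theorem minOp_map_single (h : IsUnit (kkt A Q).det) (a : μ) :
    minOp (A.map (Complex.ofRealHom : ℝ →+* ℂ)) (Q.map (Complex.ofRealHom : ℝ →+* ℂ)) *ᵥ Pi.single a 1 =
      fun i => (((minOp A Q *ᵥ Pi.single a 1) i : ℝ) : ℂ) := by
  rw [minOp_map _ _ _ h, ← ofReal_single, ofReal_mulVec]

/-- **(D) `isUnit_det_kkt_accretive` — `hdet` FOR FREE** [our proof; gan24-idea-1 g45 (D) re-typed over `ℂ`]: `A` real PSD, `K` real symmetric,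
`kkt(A,Q)` nonsingular ⟹ `kkt(Â + i•K̂, Q̂)` nonsingular — NO smallness of `K`. -/
theorem isUnit_det_kkt_accretive (hA : A.PosSemidef) (hK : Kᵀ = K) (h : IsUnit (kkt A Q).det) :
    IsUnit (kkt (A.map (Complex.ofRealHom : ℝ →+* ℂ) + Complex.I • K.map (Complex.ofRealHom : ℝ →+* ℂ))
      (Q.map (Complex.ofRealHom : ℝ →+* ℂ))).det := by
  set Ac := A.map (Complex.ofRealHom : ℝ →+* ℂ) with hAc
  set Kc := K.map (Complex.ofRealHom : ℝ →+* ℂ) with hKc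
  set Qc := Q.map (Complex.ofRealHom : ℝ →+* ℂ) with hQc
  have hreal : IsUnit (kkt Ac Qc).det := by rw [hAc, hQc, kkt_map]; exact isUnit_det_map _ _ h
  have hinj : Function.Injective (kkt Ac Qc).mulVec := mulVec_injective_iff_isUnit.mpr ((isUnit_iff_isUnit_det _).mpr hreal)
  have hker : ∀ z : ν ⊕ μ → ℂ, kkt (Ac + Complex.I • Kc) Qc *ᵥ z = 0 → z = 0 := by
    intro z h0
    rw [kkt_eq_fromBlocks, fromBlocks_mulVec] at h0
    set u : ν → ℂ := z ∘ Sum.inl with hudef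
    set l : μ → ℂ := z ∘ Sum.inr with hldef
    have h1 : (Ac + Complex.I • Kc) *ᵥ u + Qcᵀ *ᵥ l = 0 := by
      funext i; have := congr_fun h0 (Sum.inl i); simpa using this
    have h2 : Qc *ᵥ u = 0 := by
      funext a; have := congr_fun h0 (Sum.inr a); simpa using this
    have h2' : Qc *ᵥ star u = 0 := by rw [hQc, ← star_map_mulVec, ← hQc, h2, star_zero]
    have h3 : star u ⬝ᵥ ((Ac + Complex.I • Kc) *ᵥ u) = 0 := by
      rw [eq_neg_of_add_eq_zero_left h1, dotProduct_neg, dotProduct_mulVec (star u), vecMul_transpose, h2', zero_dotProduct, neg_zero]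
    have h4 : (star u ⬝ᵥ (Ac *ᵥ u)).re = 0 := by
      rw [add_mulVec, smul_mulVec, dotProduct_add, dotProduct_smul, smul_eq_mul] at h3
      have him : (star u ⬝ᵥ (Kc *ᵥ u)).im = 0 := im_star_dotProduct_map_mulVec hK u
      have := congrArg Complex.re h3
      rwa [re_add_I_mul_of_im_eq_zero _ _ him, Complex.zero_re] at this
    have h5 : Ac *ᵥ u = 0 := map_mulVec_eq_zero_of_re_eq_zero hA u h4
    have hu0 : u = 0 := by
      have hm : kkt Ac Qc *ᵥ Sum.elim u 0 = kkt Ac Qc *ᵥ 0 := by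
        rw [kkt_eq_fromBlocks, fromBlocks_mulVec, mulVec_zero]
        funext i; rcases i with i | a
        · simp [h5]
        · simp [h2]
      funext i; have := congr_fun (hinj hm) (Sum.inl i); simpa using this
    have hl1 : Qcᵀ *ᵥ l = 0 := by rwa [hu0, mulVec_zero, zero_add] at h1
    have hl0 : l = 0 := by
      have hm : kkt Ac Qc *ᵥ Sum.elim 0 l = kkt Ac Qc *ᵥ 0 := by
        rw [kkt_eq_fromBlocks, fromBlocks_mulVec, mulVec_zero]
        funext i; rcases i with i | a
        · simp [hl1]
        · simp
      funext a; have := congr_fun (hinj hm) (Sum.inr a); simpa using this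
    funext i; rcases i with i | a
    · exact congr_fun hu0 i
    · exact congr_fun hl0 a
  rw [← isUnit_iff_isUnit_det]
  refine mulVec_injective_iff_isUnit.mp fun z₁ z₂ hz => ?_
  exact sub_eq_zero.mp (hker (z₁ - z₂) (by rw [mulVec_sub, hz, sub_self]))

/-- **(X) `effForm_accretive_apply`** [our proof]: `𝒮_{Â+iK̂}(a,b) = 𝒮_A(a,b) + i·(w_a·K̂u_b)`, `w_a = ℋ_Â e_a` (the REAL minimiser), `u_b = ℋ_{Â+iK̂} e_b` —
Euler–Lagrange of the accretive datum tested on the real minimiser, whose `Â`-pairing with the admissible `u_b` is `𝒮_A(a,b)`. -/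
theorem effForm_accretive_apply (hA : A.PosSemidef) (h : IsUnit (kkt A Q).det)
    (hM : IsUnit (kkt (A.map (Complex.ofRealHom : ℝ →+* ℂ) + Complex.I • K.map (Complex.ofRealHom : ℝ →+* ℂ))
      (Q.map (Complex.ofRealHom : ℝ →+* ℂ))).det) (a b : μ) :
    effForm (A.map (Complex.ofRealHom : ℝ →+* ℂ) + Complex.I • K.map (Complex.ofRealHom : ℝ →+* ℂ)) (Q.map (Complex.ofRealHom : ℝ →+* ℂ)) a b =
      ((effForm A Q a b : ℝ) : ℂ) + Complex.I *
        ((minOp (A.map (Complex.ofRealHom : ℝ →+* ℂ)) (Q.map (Complex.ofRealHom : ℝ →+* ℂ)) *ᵥ Pi.single a 1) ⬝ᵥ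
          (K.map (Complex.ofRealHom : ℝ →+* ℂ) *ᵥ
            (minOp (A.map (Complex.ofRealHom : ℝ →+* ℂ) + Complex.I • K.map (Complex.ofRealHom : ℝ →+* ℂ))
              (Q.map (Complex.ofRealHom : ℝ →+* ℂ)) *ᵥ Pi.single b 1))) := by
  set Ac := A.map (Complex.ofRealHom : ℝ →+* ℂ) with hAc
  set Kc := K.map (Complex.ofRealHom : ℝ →+* ℂ) with hKc
  set Qc := Q.map (Complex.ofRealHom : ℝ →+* ℂ) with hQc
  have hAt : Aᵀ = A := transpose_eq_of_posSemidef hA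
  have hAct : Acᵀ = Ac := by rw [hAc, transpose_map_ofReal, hAt]
  have hreal : IsUnit (kkt Ac Qc).det := by rw [hAc, hQc, kkt_map]; exact isUnit_det_map _ _ h
  set w := minOp Ac Qc *ᵥ Pi.single a 1 with hw
  set u := minOp (Ac + Complex.I • Kc) Qc *ᵥ Pi.single b 1 with hu
  have hwadm : Qc *ᵥ w = Pi.single a 1 := constraint_mulVec_minOp hreal _
  have huadm : Qc *ᵥ u = Pi.single b 1 := constraint_mulVec_minOp hM _
  -- Euler–Lagrange of the accretive datum tested on `w`
  have hT : w ⬝ᵥ ((Ac + Complex.I • Kc) *ᵥ u) = effForm (Ac + Complex.I • Kc) Qc a b := by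
    rw [hu, trial_dotProduct_minOp hM hwadm, single_dotProduct_mulVec_single']
  -- the `Â`-pairing of `w` with the admissible `u` is `𝒮_A(a,b)`
  have hX : w ⬝ᵥ (Ac *ᵥ u) = ((effForm A Q a b : ℝ) : ℂ) := by
    rw [dotProduct_mulVec_comm_of_transpose hAct, hw, trial_dotProduct_minOp hreal huadm, single_dotProduct_mulVec_single',
      hAc, hQc, effForm_map _ _ _ h, Matrix.map_apply]
    have hsym : (effForm A Q)ᵀ = effForm A Q := (minOpL_eq_transpose A Q hAt).2.2
    have hba : effForm A Q b a = effForm A Q a b := by simpa using congrFun (congrFun hsym a) b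
    rw [hba]; rfl
  rw [← hT, add_mulVec, smul_mulVec, dotProduct_add, dotProduct_smul, smul_eq_mul, hX]

/-- **(V) `re_effForm_accretive_diag`** [our proof]: `Re 𝒮_{Â+iK̂}(b,b) = Re ū_b·Âu_b` — Euler–Lagrange tested on `ū_b` (admissible because the
constraint map is REAL), the `K̂`-term being purely imaginary for symmetric `K`. -/
theorem re_effForm_accretive_diag (hK : Kᵀ = K)
    (hM : IsUnit (kkt (A.map (Complex.ofRealHom : ℝ →+* ℂ) + Complex.I • K.map (Complex.ofRealHom : ℝ →+* ℂ))
      (Q.map (Complex.ofRealHom : ℝ →+* ℂ))).det) (b : μ) :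
    (effForm (A.map (Complex.ofRealHom : ℝ →+* ℂ) + Complex.I • K.map (Complex.ofRealHom : ℝ →+* ℂ)) (Q.map (Complex.ofRealHom : ℝ →+* ℂ)) b b).re =
      (star (minOp (A.map (Complex.ofRealHom : ℝ →+* ℂ) + Complex.I • K.map (Complex.ofRealHom : ℝ →+* ℂ))
              (Q.map (Complex.ofRealHom : ℝ →+* ℂ)) *ᵥ Pi.single b 1) ⬝ᵥ
        (A.map (Complex.ofRealHom : ℝ →+* ℂ) *ᵥ
          (minOp (A.map (Complex.ofRealHom : ℝ →+* ℂ) + Complex.I • K.map (Complex.ofRealHom : ℝ →+* ℂ))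
              (Q.map (Complex.ofRealHom : ℝ →+* ℂ)) *ᵥ Pi.single b 1))).re := by
  set Ac := A.map (Complex.ofRealHom : ℝ →+* ℂ) with hAc
  set Kc := K.map (Complex.ofRealHom : ℝ →+* ℂ) with hKc
  set Qc := Q.map (Complex.ofRealHom : ℝ →+* ℂ) with hQc
  set u := minOp (Ac + Complex.I • Kc) Qc *ᵥ Pi.single b 1 with hu
  have huadm : Qc *ᵥ u = Pi.single b 1 := constraint_mulVec_minOp hM _
  have hsadm : Qc *ᵥ star u = Pi.single b 1 := by rw [hQc, ← star_map_mulVec, ← hQc, huadm, star_single]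
  have hT : star u ⬝ᵥ ((Ac + Complex.I • Kc) *ᵥ u) = effForm (Ac + Complex.I • Kc) Qc b b := by
    rw [hu, trial_dotProduct_minOp hM hsadm, single_dotProduct_mulVec_single']
  rw [← hT, add_mulVec, smul_mulVec, dotProduct_add, dotProduct_smul, smul_eq_mul]
  exact re_add_I_mul_of_im_eq_zero _ _ (im_star_dotProduct_map_mulVec hK u)

end Accretive

end Summit.QuantumFields.BalabanUV.Beta.GAN24.DerivativeRateTransferAccretive

end
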